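import Literature.MathematicalPhysics.QuantumFieldTheory.Balaban1983to89.T4DatumAssembly
import Literature.MathematicalPhysics.QuantumFieldTheory.Balaban1983to89.B14NodeKnit

/-!
# `Balaban1983to89.B14NodeKnitMachine` — YM-DAG node N11 · [Balaban1988Convergent] CMP **119** (1988) 243–285, Theorem 1 p. 262
# (with the Theorem of p. 245 and the ASSUMED operation 𝐑 of p. 244): the N11 knit AT AN ASSEMBLED CONSTRUCTION
# `w.C = M.construction av` of the datum assembler `T4DatumAssembly.RGMachine`, the induction (0.2) run DIRECTLY on the machine's
# density tower `ρ_k = (RT)^k ρ₀` — MODULO EXACTLY TWO DISPLAYED PRINTED SLOTS (the start, the T-step = the Theorem of p. 245)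

statement-level bookkeeping over published theorems with citation tags; kernel-checked compositions of tree theorems;
nothing here is a claim about the Yang–Mills mass gap.

CITATION HEADER (lean-in-tree rule).  Source: T. Bałaban, *Convergent renormalization expansions for lattice gauge theories*,
Commun. Math. Phys. **119**, 243–285 (1988), doi:10.1007/bf01217741 [Balaban1988Convergent] (cell paper B14 = «[III]»).  Seat
`pub-ymgap-dag-n11-a` (YM-PLAN Track A, HUMAN RULING D-0062: the KNIT-BY-NAME seat of node N11; chair rulings R420 ∕ R422 ∕ R424;
director-ym LINE №12 ∕ №18).  Companion of `…B14NodeKnit` (p408840: `b14_main_of_thmP245I`, the knit over a (0.2) trajectory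
`D : Step.DensityRGI` on an abstract 𝐑-carrier `V : PrintedCarriers14R`) and `…B14NodeKnitFrame` (p409355).  BY NAME and UNCHANGED:
`…Dag` (`B14_main` :224), `…DagBinding` (`leavesP` :1412, `PrintedCarriers14R` :1109, `ROpLeaf` :1128, `Upstream.ofPrintedAllXPN`),
`…DagDischargedII` (`ofPrintedAllXPN_leaves`), `…B14` (`RAssumedP244` :398, `ThmP245PrintedI` :470, `ThmP245SpacesI` :478),
`…T4DatumAssembly` (`RGMachine`, `RGMachine.dens ∕ dens_succ ∕ rhoZero ∕ construction ∕ construction_sect2Form`, `datumOfRecord`,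
`datumOfRecord_C`; p409400, seat pub-ymgap-dag-n23-a), `…AveragingRT` (`rnTransport`), `…Node00.DatumAvLayer` (`avOfRecord`,
`TrhoOfRecord`, `rhoZeroOfRecord`).

WHY THIS FILE (the located obstruction it removes).  `…B14NodeKnit.b14_main_of_thmP245I` carries the trajectory as a
`Step.DensityRGI V.P V.G av`, whose field `T : ∀ k, RTOpI V.P k V.G (av k)` asks an HONEST renormalisation transformation (push-forward
identity `Setup.IsRT` on integrable densities) at EVERY level `k`; at NODE 00's objects of record the only constructor is
`T4FiniteEpsInhabited.rtOpIOfAC`, which needs the Haar bracket `HaarAC (av K k).avg` — a tree theorem ONLY in the standing range `k < K`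
(`Node00.avOfRecord_haarAC`, `T4DatumAssembly.RGMachine.integrable_dens`).  So the `DensityRGI`-carried knit does not instantiate at the
record by `obtain` + `rfl`.  But the node never reads `IsRT`: Theorem 1's proof structure (p. 262, verbatim: *«the sequence of densities
{ρ_k}, generated by successive applications of the operations 𝐑T to the density ρ₀ = exp[−(1∕g₀²)A − E], satisfies all the inductive
assumptions»*) is an induction on `k` along `ρ_{k+1} = 𝐑_k(T_k ρ_k)` that uses the OPERATOR `T_k` only.  Here the induction is run on the
assembler's tower `RGMachine.dens M av p` itself (`dens_succ : ρ_{k+1} = M.R p k (rnTransport (av p.K k).avg ρ_k)`, `rfl`), with the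
T-step slot stated for the transport `rnTransport (av p.K k).avg` — no `RTOpI` family, no measurability, no Haar bracket.  At NODE 00's
Stage-5 record (seat pub-ymgap-node00-def, `Node00/Record5.lean` staged 2026-08-25: `datumOfRecord₅ θ := datumOfRecord F N
(machineOfRecord₅ θ)`, `Sect2Form p k := S218 p k ρ_k` read AT the densities, `dens_machineOfRecord₅`) every theorem below instantiates
by `obtain ⟨θ, …⟩` and rewriting.

WHAT THIS FILE PROVES (0 `sorry`, 0 `def`, standard axioms; every ingredient BY NAME).
§1 `inSpace_dens_of_steps` — THE INDUCTION (0.2) ALONG THE MACHINE'S TOWER: a start `S 0 ρ₀`, the T-step `S k ρ_k → Scorr (k+1) (T_k ρ_k)`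
   for `k < K` (the Theorem of p. 245, sequence reading, `T_k = rnTransport (av p.K k).avg`) and the assumed 𝐑 `B14.RAssumedP244 (M.R p)
   Scorr S K` (p. 244) give `S k ρ_k` for every `k ≤ K`.  `…_of_spaces`: the same from the SPACE reading of the T-step (second remark of
   p. 262).  `…_of_thmP245I`: the same from `B14.ThmP245PrintedI T (M.dens av p) S Scorr K` for ANY `RTOpI` family `T` that AGREES with the
   transport on the trajectory below level `K` (so the day an unguarded `RTOpI` family of record exists, the B14 module's own slot name is
   consumed verbatim).
§2 **`b14_main_of_machine`** — THE KNIT AT AN ASSEMBLED CONSTRUCTION: for every machine `M : RGMachine F G`, averaging family `av`, binding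
   world `w` with `w.C = M.construction av` and run `P`, `Dag.B14_main (leavesP w P)` follows from
   (P1) `hV` the world's 𝐑-leaf gives the p. 244 assumption FOR THE MACHINE'S 𝐑: `(leavesP w P).rOperation → B14.RAssumedP244 (M.R P) Scorr S P.K`
        (at a record whose 𝐑-carrier is BUILT from the machine — `V P = ⟨F.P P.K, G, …, P.K, M.R P, Scorr, S⟩`, NODE 00 Stage 7 — this is
        `Iff.rfl`: `rOpLeaf_mk_iff`; and at the N-binding `Upstream.ofPrintedAllXPN X Y Z (V P) W` the leaf IS `ROpLeaf (V P)`: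
        `b14_main_of_machine_ofPrintedAllXPN` has NO (P1));
   (P3) `hS` the machine's §2-form clause is implied by membership in the index-`k` space AT THE DENSITY: `S k ρ_k → M.Sect2Form P k`, `k ≤ P.K`
        (at Stage 5 `Sect2Form p k := S218 p k ρ_k`, so with `S := S218 P` this is `id` after `dens_machineOfRecord₅`);
   and EXACTLY TWO DISPLAYED PRINTED SLOTS handed the node's antecedents they may consume:
   (S0) `h0` the START (Thm 1 p. 262): under the interval hypothesis, `S 0 (M.rhoZero P)` — `ρ₀ = e^{−E(P)}·exp(−A∕g₀²)`, the machine's Wilson start;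
   (S1) `hT` THE THEOREM OF p. 245 (*«If ρ_k satisfies the assumptions described in detail in Sect. 2, then Tρ_k satisfies also the
        corresponding assumptions.»*) along the tower: `∀ k < P.K, S k ρ_k → Scorr (k+1) (rnTransport (av P.K k).avg ρ_k)`, GIVEN the in-edge
        leaves `b7 … b11`, the interval hypothesis, the small-field inductive assumptions and the flow control (2.6).
   Proof = `inSpace_dens_of_steps` + `RGMachine.construction_sect2Form`.  Variants: `…_spaces` (S1 in the space reading), `…_thmP245I` (S1 as
   `B14.ThmP245PrintedI` over an agreeing `RTOpI` family), `…_ofPrintedAllXPN` ((P1) discharged at the N-binding over the machine-built carrier),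
   `…_datum` (worlds bound to the assembled DATUM `(M.datum av hmeas hac).C`), and the located EQUIVALENCE `b14_main_iff_of_readAtDensities`:
   when the machine's clause is READ AT THE DENSITIES (`M.Sect2Form P k ↔ S k ρ_k`, the Stage-5∕6 design) the node statement at `(w, P)` IS,
   antecedent for antecedent, Theorem 1's sentence «ρ_k satisfies the inductive assumptions (index k) for all k ≤ K» under the 𝐑-leaf and the
   interval hypothesis — so N11 at such a record is exactly as non-trivial as the format predicate `S` (referee's vacuity audit A4, in kernel form).
§3 AT `SU(N)` AND NODE 00's AVERAGING OF RECORD: `b14_main_of_machine_record` (T-step through `Node00.TrhoOfRecord F N P.K k` BY NAME, start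
   `M.rhoZero P = Node00.rhoZeroOfRecord F N P.K P.g0 (M.E P)` by `rfl`), `b14_main_of_datumOfRecord` (worlds bound to
   `(T4DatumAssembly.datumOfRecord F N M).C`), and the `S_N11 Rec` shape `atRecord_b14_main_of_machine`: for ANY record predicate `Rec` whose
   worlds are bound to an assembled construction of record and supply, per run, space families with (P1), (P3), (S0), (S1) —
   `∀ w, Rec w → ∀ P, Dag.B14_main (leavesP w P)` (R420 (C) ∕ R422: typed over a record PARAMETER).

SLOT CENSUS FOR N11 AT AN ASSEMBLED RECORD (numbers, not adjectives).  (P1) is definitional once the 𝐑-carrier of record is built from the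
machine's `R` and the two format predicates (NODE 00 Stage 7, `Node00/ROperationOfRecord.lean`, seat pub-ymgap-node00-def-R); (P3) is
definitional at Stage 5 (`Node00.sect2Form_datumOfRecord₅_iff`); (S0) is Sect. 1 of [Balaban1988Convergent] at `k = 0` for the Wilson start
(representation (2.18) with `𝐓₀ = 1`; the bound clauses are vacuous at `k = 0` in the `Step.LFHyp` typing); (S1) is Sects. 1–3 of the paper at
the objects of record — its statement needs the Stage-6 format predicates `S218` («the assumptions described in detail in Sect. 2», index `k`)
and its T-image companion («the corresponding assumptions», p. 262 ∕ p. 279), both RESIDUAL data of `Node00.Residual₅` today.  Nothing of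
(S0), (S1) is asserted here.

HONEST FRAMING.  A count-neutral SLOT landing (R429 (4)(i)): the node N11 is NOT discharged; Theorem 1's analytic content (the Theorem of
p. 245) is a displayed hypothesis, the 𝐑 operation is the printed ASSUMPTION of p. 244 (constructed only in [Balaban1989LargeFieldI] ∕
[Balaban1989LargeFieldII] = nodes N12 ∕ N13).  `RGMachine` is dag-n23-a's input bundle read as DATA — no machine is chosen here, and a
machine with a trivial `Sect2Form` makes every hypothesis below contentless (`b14_main_iff_of_readAtDensities` displays exactly where the
content sits).  One finite four-torus programme at fixed `ε`, Bałaban AS PRINTED with locators; nothing continuum ∕ ℝ⁴ ∕ OS ∕ mass gap ∕ Clay.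
-/

noncomputable section

namespace Literature.MathematicalPhysics.QuantumFieldTheory.Balaban1983to89.B14NodeKnitMachine

open DagBinding T4DatumAssembly AveragingRT T4Continuum T4FiniteEpsInhabited

/-! ## §1. The induction (0.2) along the machine's density tower `ρ_k = (RT)^k ρ₀` -/

section Tower

variable {F : T4Family} {G : Type} [GaugeGroup G] [MeasurableSpace G] [HaarData G]
  (M : RGMachine F G) (av : (K j : ℕ) → Averaging (F.P K) j G) (p : B12.RunParams)

/-- **THE INDUCTION ALONG (0.2) ON THE MACHINE'S TOWER** ([Balaban1988Convergent] Thm 1 p. 262, verbatim: *«the sequence of densities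
{ρ_k}, generated by successive applications of the operations 𝐑T to the density ρ₀ = exp[−(1∕g₀²)A − E], satisfies all the inductive
assumptions»*; p. 245: *«This whole paper gives a proof of this»*): a start `ρ₀` in the index-0 space, the Theorem of p. 245 at each step
`k < K` in its sequence reading for the transport `T_k = rnTransport (av p.K k).avg`, and the assumed 𝐑 of p. 244 for the machine's `R`
give `ρ_k ∈ S k` for every `k ≤ K`, along `RGMachine.dens_succ : ρ_{k+1} = R_k (T_k ρ_k)`.  Every hypothesis is a displayed slot; pure
logic (induction on `k`) — the `RTOpI`-free twin of `B14.inductiveAssumptions_of_thmP245I`. [cite: Balaban1988Convergent, Thm 1 p.262; Theorem p.245; p.244] -/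
theorem inSpace_dens_of_steps (S Scorr : (k : ℕ) → Density (F.P p.K) k G → Prop) {K : ℕ}
    (h0 : S 0 (M.rhoZero p))
    (hT : ∀ k, k < K → S k (M.dens av p k) → Scorr (k + 1) (rnTransport (av p.K k).avg (M.dens av p k)))
    (hR : B14.RAssumedP244 (M.R p) Scorr S K) : ∀ k, k ≤ K → S k (M.dens av p k) := by
  intro k
  induction k with
  | zero => intro _; exact h0
  | succ k ih =>
    intro hk
    have hk' : k < K := Nat.lt_of_succ_le hk
    rw [RGMachine.dens_succ]
    exact hR k hk' _ (hT k hk' (ih hk'.le))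

/-- The same from the SPACE reading of the T-step (second remark of p. 262, verbatim: *«For a given index k we introduce the space of all
densities satisfying the conditions of the inductive assumption. The theorem states that the operation 𝐑T transforms the space with the
index k into the space with the index k+1.»*, its T-half): `∀ k < K, ∀ ρ, S k ρ → Scorr (k+1) (T_k ρ)`. [cite: Balaban1988Convergent, Theorem p.245 with remark p.262] -/
theorem inSpace_dens_of_spaces (S Scorr : (k : ℕ) → Density (F.P p.K) k G → Prop) {K : ℕ}
    (h0 : S 0 (M.rhoZero p))
    (hT : ∀ k, k < K → ∀ ρ : Density (F.P p.K) k G, S k ρ → Scorr (k + 1) (rnTransport (av p.K k).avg ρ))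
    (hR : B14.RAssumedP244 (M.R p) Scorr S K) : ∀ k, k ≤ K → S k (M.dens av p k) :=
  inSpace_dens_of_steps M av p S Scorr h0 (fun k hk h => hT k hk _ h) hR

/-- The same with the T-step in the B14 module's own typing `B14.ThmP245PrintedI T (M.dens av p) S Scorr K` over ANY family of honest
renormalisation transformations `T k : RTOpI (F.P p.K) k G (av p.K k)` that AGREES WITH THE TRANSPORT on the trajectory below level `K`
(`hTT`; e.g. `T k := T4FiniteEpsInhabited.rtOpIOfAC (av p.K k) …` wherever the Haar bracket is available, agreeing by `rfl`).
[cite: Balaban1988Convergent, Theorem p.245; Thm 1 p.262] -/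
theorem inSpace_dens_of_thmP245I (S Scorr : (k : ℕ) → Density (F.P p.K) k G → Prop) {K : ℕ}
    (T : (k : ℕ) → RTOpI (F.P p.K) k G (av p.K k))
    (hTT : ∀ k, k < K → (T k).T (M.dens av p k) = rnTransport (av p.K k).avg (M.dens av p k))
    (h0 : S 0 (M.rhoZero p)) (hT : B14.ThmP245PrintedI T (M.dens av p) S Scorr K)
    (hR : B14.RAssumedP244 (M.R p) Scorr S K) : ∀ k, k ≤ K → S k (M.dens av p k) :=
  inSpace_dens_of_steps M av p S Scorr h0 (fun k hk h => hTT k hk ▸ hT k hk h) hR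

/-- **(P1) AT A MACHINE-BUILT 𝐑-CARRIER IS DEFINITIONAL.**  For the carrier `⟨P, G, …, K, R, Scorr, S⟩ : PrintedCarriers14R` assembled from
lattice parameters, a gauge group, a number of steps, an operation `R` and two space families (the shape NODE 00's Stage 7 gives the
𝐑-carrier of record: `R` the machine's, `S ∕ Scorr` the Stage-6 format predicates), the bound leaf `ROpLeaf` IS `B14.RAssumedP244 R Scorr S K`
(`Iff.rfl`). [cite: Balaban1988Convergent, p.244] -/
theorem rOpLeaf_mk_iff (P : Params) (G : Type) [GaugeGroup G] [MeasurableSpace G] [HaarData G] (K : ℕ)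
    (R : (k : ℕ) → Density P (k + 1) G → Density P (k + 1) G) (Scorr S : (k : ℕ) → Density P k G → Prop) :
    ROpLeaf ⟨P, G, inferInstance, inferInstance, inferInstance, K, R, Scorr, S⟩ ↔ B14.RAssumedP244 R Scorr S K :=
  Iff.rfl

end Tower

/-! ## §2. THE KNIT at an assembled construction `w.C = M.construction av` -/

section Knit

variable {F : T4Family} {G : Type} [GaugeGroup G] [MeasurableSpace G] [HaarData G]
  (M : RGMachine F G) (av : (K j : ℕ) → Averaging (F.P K) j G) (w : WorldP) (P : B12.RunParams)

/-- **N11 · `Dag.B14_main (leavesP w P)` AT AN ASSEMBLED CONSTRUCTION, KNIT BY NAME** ([Balaban1988Convergent] Thm 1 p. 262 with the Theorem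
of p. 245 and the assumed 𝐑 of p. 244).  Binding: `hC : w.C = M.construction av` (the world's construction is the assembler's at the
machine `M` — at NODE 00's Stage-5 record `M = machineOfRecord₅ θ`, `av = avOfRecord F N`).  Pins: (P1) `hV` the world's 𝐑-leaf gives the
p. 244 assumption for the machine's `R` and the space families `S`, `Scorr`; (P3) `hS` membership of `ρ_k` in the index-`k` space gives the
machine's §2-form clause at `(P, k)`.  Slots (displayed, printed, NOT proved here): (S0) `h0` the Wilson start `M.rhoZero P` lies in the
index-0 space, under the interval hypothesis (Thm 1 p. 262: *«ρ₀ = exp[−(1∕g₀²)A − E]»*); (S1) `hT` THE THEOREM OF p. 245 along the tower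
(*«If ρ_k satisfies the assumptions described in detail in Sect. 2, then Tρ_k satisfies also the corresponding assumptions.»*), for the
transport `rnTransport (av P.K k).avg`, GIVEN the node's in-edges `b7 … b11` ([12] = B7, [14] = B8, [13] = B9, [16] = B10, [15] = B11), the
interval hypothesis, the small-field inductive assumptions ([I], [II]) and the flow control (2.6).  Proof = `inSpace_dens_of_steps`; the
𝐑-leaf is consumed through (P1), not discarded.  Count-neutral slot landing; nothing of Sects. 1–3 asserted.
[cite: Balaban1988Convergent, Thm 1 p.262; Theorem p.245; p.244] -/
theorem b14_main_of_machine (hC : w.C = M.construction av) (S Scorr : (k : ℕ) → Density (F.P P.K) k G → Prop)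
    (hV : (leavesP w P).rOperation → B14.RAssumedP244 (M.R P) Scorr S P.K)
    (hS : ∀ k, k ≤ P.K → S k (M.dens av P k) → M.Sect2Form P k)
    (h0 : (leavesP w P).smallCouplings → S 0 (M.rhoZero P))
    (hT : (leavesP w P).b7 → (leavesP w P).b8 → (leavesP w P).b9 → (leavesP w P).b10 → (leavesP w P).b11 →
      (leavesP w P).smallCouplings → (leavesP w P).smallFieldInductive → (leavesP w P).flowControl →
        ∀ k, k < P.K → S k (M.dens av P k) → Scorr (k + 1) (rnTransport (av P.K k).avg (M.dens av P k))) :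
    Dag.B14_main (leavesP w P) := by
  intro h7 h8 h9 h10 h11 hsf hfc hrop hsc k hk
  show (w.C P).Sect2Form k
  rw [hC, RGMachine.construction_sect2Form]
  exact hS k hk (inSpace_dens_of_steps M av P S Scorr (h0 hsc) (hT h7 h8 h9 h10 h11 hsc (hsf hsc) (hfc hsc)) (hV hrop) k hk)

/-- The same with slot (S1) in the SPACE reading (second remark of p. 262, T-half: every density of the index-`k` space is transported into the
«corresponding» space). [cite: Balaban1988Convergent, Theorem p.245 with remark p.262] -/
theorem b14_main_of_machine_spaces (hC : w.C = M.construction av) (S Scorr : (k : ℕ) → Density (F.P P.K) k G → Prop)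
    (hV : (leavesP w P).rOperation → B14.RAssumedP244 (M.R P) Scorr S P.K)
    (hS : ∀ k, k ≤ P.K → S k (M.dens av P k) → M.Sect2Form P k)
    (h0 : (leavesP w P).smallCouplings → S 0 (M.rhoZero P))
    (hT : (leavesP w P).b7 → (leavesP w P).b8 → (leavesP w P).b9 → (leavesP w P).b10 → (leavesP w P).b11 →
      (leavesP w P).smallCouplings → (leavesP w P).smallFieldInductive → (leavesP w P).flowControl →
        ∀ k, k < P.K → ∀ ρ : Density (F.P P.K) k G, S k ρ → Scorr (k + 1) (rnTransport (av P.K k).avg ρ)) :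
    Dag.B14_main (leavesP w P) :=
  b14_main_of_machine M av w P hC S Scorr hV hS h0 fun h7 h8 h9 h10 h11 hsc hsf hfc k hk h =>
    hT h7 h8 h9 h10 h11 hsc hsf hfc k hk _ h

/-- The same with slot (S1) typed as the B14 module's `B14.ThmP245PrintedI T (M.dens av P) S Scorr P.K` over any `RTOpI` family `T` agreeing
with the transport on the trajectory below level `P.K` (`hTT`). [cite: Balaban1988Convergent, Theorem p.245; Thm 1 p.262] -/
theorem b14_main_of_machine_thmP245I (hC : w.C = M.construction av) (S Scorr : (k : ℕ) → Density (F.P P.K) k G → Prop)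
    (T : (k : ℕ) → RTOpI (F.P P.K) k G (av P.K k))
    (hTT : ∀ k, k < P.K → (T k).T (M.dens av P k) = rnTransport (av P.K k).avg (M.dens av P k))
    (hV : (leavesP w P).rOperation → B14.RAssumedP244 (M.R P) Scorr S P.K)
    (hS : ∀ k, k ≤ P.K → S k (M.dens av P k) → M.Sect2Form P k)
    (h0 : (leavesP w P).smallCouplings → S 0 (M.rhoZero P))
    (hT : (leavesP w P).b7 → (leavesP w P).b8 → (leavesP w P).b9 → (leavesP w P).b10 → (leavesP w P).b11 →
      (leavesP w P).smallCouplings → (leavesP w P).smallFieldInductive → (leavesP w P).flowControl →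
        B14.ThmP245PrintedI T (M.dens av P) S Scorr P.K) :
    Dag.B14_main (leavesP w P) :=
  b14_main_of_machine M av w P hC S Scorr hV hS h0 fun h7 h8 h9 h10 h11 hsc hsf hfc k hk h =>
    hTT k hk ▸ hT h7 h8 h9 h10 h11 hsc hsf hfc k hk h

/-- **At the N-binding over the MACHINE-BUILT 𝐑-carrier** `w.up P = Upstream.ofPrintedAllXPN X Y Z ⟨F.P P.K, G, …, P.K, M.R P, Scorr, S⟩ W`
(the shape of NODE 00's Stage-7 upstream block: the 𝐑-carrier's operation IS the machine's `R`, its spaces ARE the format predicates) pin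
(P1) DISAPPEARS: the world's 𝐑-leaf is `ROpLeaf` of that carrier (`DagDischargedII.ofPrintedAllXPN_leaves`), i.e. `B14.RAssumedP244 (M.R P)
Scorr S P.K` itself (`rOpLeaf_mk_iff`). [cite: Balaban1988Convergent, Thm 1 p.262; Theorem p.245; p.244] -/
theorem b14_main_of_machine_ofPrintedAllXPN (hC : w.C = M.construction av)
    (S Scorr : (k : ℕ) → Density (F.P P.K) k G → Prop) (X : PrintedCarriersR) (Y : PrintedCarriers9X)
    (Z : PrintedCarriers11) (W : PrintedCarriers15)
    (hup : w.up P = Upstream.ofPrintedAllXPN X Y Z ⟨F.P P.K, G, inferInstance, inferInstance, inferInstance, P.K, M.R P, Scorr, S⟩ W)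
    (hS : ∀ k, k ≤ P.K → S k (M.dens av P k) → M.Sect2Form P k)
    (h0 : (leavesP w P).smallCouplings → S 0 (M.rhoZero P))
    (hT : (leavesP w P).b7 → (leavesP w P).b8 → (leavesP w P).b9 → (leavesP w P).b10 → (leavesP w P).b11 →
      (leavesP w P).smallCouplings → (leavesP w P).smallFieldInductive → (leavesP w P).flowControl →
        ∀ k, k < P.K → S k (M.dens av P k) → Scorr (k + 1) (rnTransport (av P.K k).avg (M.dens av P k))) :
    Dag.B14_main (leavesP w P) :=
  b14_main_of_machine M av w P hC S Scorr
    (fun h => (rOpLeaf_mk_iff (F.P P.K) G P.K (M.R P) Scorr S).1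
      (B14NodeKnit.rOpLeaf_of_up_eq _ w P X Y Z W hup h)) hS h0 hT

/-- **At a world bound to the assembled DATUM** `(M.datum av hmeas hac).C` (`T4DatumAssembly.RGMachine.datum`; its construction is
`M.construction av` by `rfl`) the knit reads verbatim. [cite: Balaban1988Convergent, Thm 1 p.262; Theorem p.245; p.244] -/
theorem b14_main_of_machine_datum [RegularGaugeGroup G] (hmeas : ∀ K j, Measurable (av K j).avg)
    (hac : ∀ K k, k < K → HaarAC (av K k).avg) (hC : w.C = (M.datum av hmeas hac).C)
    (S Scorr : (k : ℕ) → Density (F.P P.K) k G → Prop)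
    (hV : (leavesP w P).rOperation → B14.RAssumedP244 (M.R P) Scorr S P.K)
    (hS : ∀ k, k ≤ P.K → S k (M.dens av P k) → M.Sect2Form P k)
    (h0 : (leavesP w P).smallCouplings → S 0 (M.rhoZero P))
    (hT : (leavesP w P).b7 → (leavesP w P).b8 → (leavesP w P).b9 → (leavesP w P).b10 → (leavesP w P).b11 →
      (leavesP w P).smallCouplings → (leavesP w P).smallFieldInductive → (leavesP w P).flowControl →
        ∀ k, k < P.K → S k (M.dens av P k) → Scorr (k + 1) (rnTransport (av P.K k).avg (M.dens av P k))) :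
    Dag.B14_main (leavesP w P) :=
  b14_main_of_machine M av w P (by rw [hC, RGMachine.datum_C]) S Scorr hV hS h0 hT

/-- **WHERE THE CONTENT SITS (kernel form of the referee's vacuity audit A4 for N11).**  At an assembled construction whose §2-form clause is
READ AT THE DENSITIES — `M.Sect2Form P k ↔ S k ρ_k` for `k ≤ P.K` (NODE 00's Stage-5∕6 design: `Sect2Form p k := S218 p k ρ_k`) — the node
statement `Dag.B14_main (leavesP w P)` IS, antecedent for antecedent, Theorem 1's sentence at the run: the in-edges, the small-field
inductive assumptions and the flow control under the interval hypothesis, and the 𝐑-leaf, imply «`ρ_k` satisfies the inductive assumptions with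
index `k` for every `k ≤ K`» along the machine's tower.  So N11 at such a record carries exactly the content of the format predicate `S`: trivial
`S` ⇒ trivial node (`Node00.WorldFrame.b14_main_of_trivial_sect2Form`'s reading), Bałaban's (2.1)–(2.42) ⇒ Theorem 1 verbatim.
[cite: Balaban1988Convergent, Thm 1 p.262] -/
theorem b14_main_iff_of_readAtDensities (hC : w.C = M.construction av) (S : (k : ℕ) → Density (F.P P.K) k G → Prop)
    (hSF : ∀ k, k ≤ P.K → (M.Sect2Form P k ↔ S k (M.dens av P k))) :
    Dag.B14_main (leavesP w P) ↔
      ((leavesP w P).b7 → (leavesP w P).b8 → (leavesP w P).b9 → (leavesP w P).b10 → (leavesP w P).b11 →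
        ((leavesP w P).smallCouplings → (leavesP w P).smallFieldInductive) →
        ((leavesP w P).smallCouplings → (leavesP w P).flowControl) →
        (leavesP w P).rOperation → (leavesP w P).smallCouplings → ∀ k, k ≤ P.K → S k (M.dens av P k)) := by
  have key : ∀ k, k ≤ P.K → ((w.C P).Sect2Form k ↔ S k (M.dens av P k)) := fun k hk => by
    rw [hC, RGMachine.construction_sect2Form]; exact hSF k hk
  constructor
  · intro h h7 h8 h9 h10 h11 hsf hfc hrop hsc k hk
    exact (key k hk).1 (h h7 h8 h9 h10 h11 hsf hfc hrop hsc k hk)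
  · intro h h7 h8 h9 h10 h11 hsf hfc hrop hsc k hk
    exact (key k hk).2 (h h7 h8 h9 h10 h11 hsf hfc hrop hsc k hk)

/-- Under the same reading, N11 at `(w, P)` FOLLOWS from the bare induction data — start, T-step, 𝐑-assumption — with NO pin (P3): the
Stage-5∕6 shape of the knit (`S := S218 P`). [cite: Balaban1988Convergent, Thm 1 p.262; Theorem p.245; p.244] -/
theorem b14_main_of_machine_readAtDensities (hC : w.C = M.construction av)
    (S Scorr : (k : ℕ) → Density (F.P P.K) k G → Prop)
    (hSF : ∀ k, k ≤ P.K → (M.Sect2Form P k ↔ S k (M.dens av P k)))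
    (hV : (leavesP w P).rOperation → B14.RAssumedP244 (M.R P) Scorr S P.K)
    (h0 : (leavesP w P).smallCouplings → S 0 (M.rhoZero P))
    (hT : (leavesP w P).b7 → (leavesP w P).b8 → (leavesP w P).b9 → (leavesP w P).b10 → (leavesP w P).b11 →
      (leavesP w P).smallCouplings → (leavesP w P).smallFieldInductive → (leavesP w P).flowControl →
        ∀ k, k < P.K → S k (M.dens av P k) → Scorr (k + 1) (rnTransport (av P.K k).avg (M.dens av P k))) :
    Dag.B14_main (leavesP w P) :=
  b14_main_of_machine M av w P hC S Scorr hV (fun k hk h => (hSF k hk).2 h) h0 hT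

end Knit

/-! ## §3. At `SU(N)` and NODE 00's averaging of record; the `S_N11 Rec` shape over machines -/

section Record

variable (F : T4Family) (N : ℕ) [NeZero N] (M : RGMachine F (Matrix.specialUnitaryGroup (Fin N) ℂ))
  (w : WorldP) (P : B12.RunParams)

/-- The machine's Wilson start on `SU(N)` IS NODE 00's initial density of record `Node00.rhoZeroOfRecord F N P.K P.g0 (M.E P)` (`rfl`).
[cite: Balaban1988Convergent, Thm 1 p.262 (bookkeeping)] -/
theorem rhoZero_eq_rhoZeroOfRecord : M.rhoZero P = Node00.rhoZeroOfRecord F N P.K P.g0 (M.E P) := rfl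

/-- Along the averaging of record the machine's tower steps by NODE 00's renormalisation transform of record:
`ρ_{k+1} = M.R P k (Node00.TrhoOfRecord F N P.K k ρ_k)` (`rfl`). [cite: Balaban1988Convergent, (0.2) p.244 (bookkeeping)] -/
theorem dens_succ_eq_TrhoOfRecord (k : ℕ) :
    M.dens (Node00.avOfRecord F N) P (k + 1) =
      M.R P k (Node00.TrhoOfRecord F N P.K k (M.dens (Node00.avOfRecord F N) P k)) := rfl

/-- **N11 AT AN ASSEMBLED CONSTRUCTION OF RECORD** `w.C = M.construction (Node00.avOfRecord F N)` (gauge group `SU(N)`, Bałaban's block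
averaging of record): as `b14_main_of_machine`, with the T-step slot through NODE 00's renormalisation transform of record
`Node00.TrhoOfRecord F N P.K k` BY NAME and the start `Node00.rhoZeroOfRecord F N P.K P.g0 (M.E P)`.  The shape NODE 00's Stage-5 record
instantiates (`machineOfRecord₅ θ`, `densOfRecord₅ θ P = M.dens …` by `dens_machineOfRecord₅`). [cite: Balaban1988Convergent, Thm 1 p.262; Theorem p.245; p.244] -/
theorem b14_main_of_machine_record (hC : w.C = M.construction (Node00.avOfRecord F N))
    (S Scorr : (k : ℕ) → Density (F.P P.K) k (Matrix.specialUnitaryGroup (Fin N) ℂ) → Prop)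
    (hV : (leavesP w P).rOperation → B14.RAssumedP244 (M.R P) Scorr S P.K)
    (hS : ∀ k, k ≤ P.K → S k (M.dens (Node00.avOfRecord F N) P k) → M.Sect2Form P k)
    (h0 : (leavesP w P).smallCouplings → S 0 (Node00.rhoZeroOfRecord F N P.K P.g0 (M.E P)))
    (hT : (leavesP w P).b7 → (leavesP w P).b8 → (leavesP w P).b9 → (leavesP w P).b10 → (leavesP w P).b11 →
      (leavesP w P).smallCouplings → (leavesP w P).smallFieldInductive → (leavesP w P).flowControl →
        ∀ k, k < P.K → S k (M.dens (Node00.avOfRecord F N) P k) →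
          Scorr (k + 1) (Node00.TrhoOfRecord F N P.K k (M.dens (Node00.avOfRecord F N) P k))) :
    Dag.B14_main (leavesP w P) :=
  b14_main_of_machine M (Node00.avOfRecord F N) w P hC S Scorr hV hS h0 hT

/-- **At a world bound to the assembled DATUM OF RECORD** `(T4DatumAssembly.datumOfRecord F N M).C` (= `M.construction (avOfRecord F N)` by
`rfl`, `datumOfRecord_C`). [cite: Balaban1988Convergent, Thm 1 p.262; Theorem p.245; p.244] -/
theorem b14_main_of_datumOfRecord (hC : w.C = (datumOfRecord F N M).C)
    (S Scorr : (k : ℕ) → Density (F.P P.K) k (Matrix.specialUnitaryGroup (Fin N) ℂ) → Prop)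
    (hV : (leavesP w P).rOperation → B14.RAssumedP244 (M.R P) Scorr S P.K)
    (hS : ∀ k, k ≤ P.K → S k (M.dens (Node00.avOfRecord F N) P k) → M.Sect2Form P k)
    (h0 : (leavesP w P).smallCouplings → S 0 (Node00.rhoZeroOfRecord F N P.K P.g0 (M.E P)))
    (hT : (leavesP w P).b7 → (leavesP w P).b8 → (leavesP w P).b9 → (leavesP w P).b10 → (leavesP w P).b11 →
      (leavesP w P).smallCouplings → (leavesP w P).smallFieldInductive → (leavesP w P).flowControl →
        ∀ k, k < P.K → S k (M.dens (Node00.avOfRecord F N) P k) →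
          Scorr (k + 1) (Node00.TrhoOfRecord F N P.K k (M.dens (Node00.avOfRecord F N) P k))) :
    Dag.B14_main (leavesP w P) :=
  b14_main_of_machine_record F N M w P (by rw [hC, datumOfRecord_C]) S Scorr hV hS h0 hT

/-- **`S_N11`-shaped over machines** (R420 (C) ∕ R422: «every stub is typed over the PINNED carriers of record, or with an explicit `Rec`
parameter»): for ANY predicate `Rec` on binding worlds such that every `Rec`-world is bound to the construction assembled from SOME machine
along the averaging of record and supplies, at every run, space families `S`, `Scorr` with the pins (P1), (P3) and the slots (S0), (S1) of
`b14_main_of_machine_record`, the node N11 holds AT EVERY RUN OF EVERY `Rec`-WORLD.  At NODE 00's Stage-5 record `Rec w := ∃ D,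
Node00.IsRecordOfRecord₅ F N D w` the machine is `machineOfRecord₅ θ` (`Node00.construction_eq_assembled`).
[cite: Balaban1988Convergent, Thm 1 p.262; Theorem p.245; p.244] -/
theorem atRecord_b14_main_of_machine (Rec : WorldP → Prop)
    (h : ∀ w, Rec w → ∃ M : RGMachine F (Matrix.specialUnitaryGroup (Fin N) ℂ),
      w.C = M.construction (Node00.avOfRecord F N) ∧ ∀ P : B12.RunParams,
        ∃ S Scorr : (k : ℕ) → Density (F.P P.K) k (Matrix.specialUnitaryGroup (Fin N) ℂ) → Prop,
          ((leavesP w P).rOperation → B14.RAssumedP244 (M.R P) Scorr S P.K) ∧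
          (∀ k, k ≤ P.K → S k (M.dens (Node00.avOfRecord F N) P k) → M.Sect2Form P k) ∧
          ((leavesP w P).smallCouplings → S 0 (Node00.rhoZeroOfRecord F N P.K P.g0 (M.E P))) ∧
          ((leavesP w P).b7 → (leavesP w P).b8 → (leavesP w P).b9 → (leavesP w P).b10 → (leavesP w P).b11 →
            (leavesP w P).smallCouplings → (leavesP w P).smallFieldInductive → (leavesP w P).flowControl →
              ∀ k, k < P.K → S k (M.dens (Node00.avOfRecord F N) P k) →
                Scorr (k + 1) (Node00.TrhoOfRecord F N P.K k (M.dens (Node00.avOfRecord F N) P k)))) :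
    ∀ w, Rec w → ∀ P : B12.RunParams, Dag.B14_main (leavesP w P) := by
  intro w hw P
  obtain ⟨M, hC, hP⟩ := h w hw
  obtain ⟨S, Scorr, hV, hS, h0, hT⟩ := hP P
  exact b14_main_of_machine_record F N M w P hC S Scorr hV hS h0 hT

end Record

end Literature.MathematicalPhysics.QuantumFieldTheory.Balaban1983to89.B14NodeKnitMachine

end
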